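/-
Copyright (c) 2026. All rights reserved.
Released under Apache 2.0 license as described in the file LICENSE.
-/
import Literature.NumberTheory.Automorphic.MaximalOrderDiscSevenLattice
import HarnessLib

/-!
# The ramified prime `7` of the maximal order `O₇` of `(−1,−7 ∣ ℚ)`: left multiplication by `j = 2ω − 1` (`nrd j = 7`) is the
# explicit bijection `(A,B,C,D) ↦ (−A−4C, B+4D, 2A+C, −2B−D)` from `{Q₇ = n}` onto `{Q₇ = 7n}` for the norm form
# `Q₇ = a² + ac + 2c² + b² + bd + 2d²`; hence `r₇(7n) = r₇(n)`, `r₇(7ᵃ) = 4`, `#{x ∈ O₇ : nrd x = 7n} = #{x ∈ O₇ : nrd x = n}`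

[tag: quaternion_algebra] [tag: quadratic_form] [tag: ramification]

Topic `NumberTheory/Automorphic`; THEOREMS ONLY (no definition, no named fact, no instance; net Literature debt `0`).
Lane `lit-hodgefound`, seat p12, gen 46 — fifth file on the definite quaternion order of discriminant `7` (after
`MaximalOrderDiscSeven{Lattice, Ramification, DedekindHasse, ClassNumberOne}`), the `D = 7` counterpart of
`MaximalOrderDiscThreeNormsThreeMul` ∕ `MaximalOrderDiscFiveNormsFiveMul`. At the ramified prime `7` the maximal order
`O₇ = ℤ⟨1, i, ω, iω⟩` has the two-sided ideal `jO₇` (`j = 2ω − 1`, `j² = −7`, `nrd j = 7`, `O₇/jO₇ ≅ 𝔽₄₉`), so `7 ∣ nrd x ⟺ x ∈ jO₇`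
and `x ↦ jx` is a bijection `{nrd = n} → {nrd = 7n}` (Eichler LNM 320 II §2: `ζ_p(s) = (1 − p^{−2s})⁻¹` for `p ∣ D`; §6 Thm. 2
(20)). In the coordinates `x = a + bi + cω + d iω` (`MaximalOrderDiscSevenLattice.reducedNorm_mk`) everything is explicit on `ℤ⁴`
and needs no class number:

* §1 `basisJ_mul_mk` (**`j·(A + Bi + Cω + D iω) = (−A−4C) + (B+4D)i + (2A+C)ω + (−2B−D)iω`**), `reducedNorm_basisJ` (`= 7`),
  `form_sevenMap` (`Q₇(φv) = 7Q₇(v)`), **`seven_dvd_form_iff`** (**`7 ∣ Q₇(a,b,c,d) ⟺ 2a + c ≡ 0 ∧ 2b + d ≡ 0 (mod 7)`** — as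
  `4Q₇ = (2a+c)² + 7c² + (2b+d)² + 7d²` and `−1` is not a square mod `7`), **`natCard_form_seven_mul`** (`#{Q₇ = 7n} = #{Q₇ = n}`),
  `natCard_form_seven_pow_mul`, **`natCard_form_seven_pow`** (`r₇(7ᵃ) = 4`);
* §2 for `O₇`: **`natCard_reducedNorm_seven_mul`** (`#{x ∈ O₇ : nrd x = 7n} = #{x ∈ O₇ : nrd x = n}`), `natCard_reducedNorm_seven_pow`
  (`= 4`), `exists_mem_eq_basisJ_mul_of_seven_dvd` (`x ∈ O₇`, `7 ∣ nrd x ⟹ x = jy`, `y ∈ O₇`).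

## Sources

* M. Eichler, LNM 320 (1973), Ch. II §2 (`ζ_p(s) = (1 − p^{−2s})⁻¹`, `p ∣ D`: one integral ideal of each norm `pᵃ`) and §6 Thm. 2
  (20). [cite: Eichler1973, Ch. II §2 and §6 Thm. 2 (20)]
* M.-F. Vignéras, LNM 800 (1980), Ch. II §1 Lemme 1.5, Cor. 1.7 (the unique maximal ideal `P = Ou = uO` above a ramified
  prime). [cite: VignerasLNM800, Ch. II §1 Lemme 1.5 and Cor. 1.7]
* A. Cardoso, A. Machiavelo, arXiv:2506.22651 (2025), §5.1 (the order `H₁,₇` and its norm form). [cite: CardosoMachiavelo2025, §5.1]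
* J. Voight, *Quaternion Algebras*, GTM 288 (2021), Exercise 17.10, Thm. 25.4.1 (`D = 7`), §13.3. [cite: Voight2021, Exercise 17.10; §13.3]

## Scope (honest)

Theorems only — no definition, no named fact, no instance. This file is the part of the `D = 7` story that is independent of the
class number; the Brandt matrices `T(7ᵃ) = 1` follow in the Brandt-setup sequel.
-/

open Quaternion
open scoped Pointwise
open Literature.NumberTheory.Automorphic.Brandt

namespace Literature.NumberTheory.Automorphic.MaxOrderDiscSeven

/-! ## §1 The `7`-map on `ℤ⁴` -/

section Form

/-- **Left multiplication by `j = 2ω − 1` in the coordinates of `O₇`: `j·(A + Bi + Cω + D iω) = (−A−4C) + (B+4D)i + (2A+C)ω + (−2B−D)iω`.**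
[cite: VignerasLNM800, Ch. II §1 Lemme 1.5] -/
theorem basisJ_mul_mk (A B C D : ℤ) :
    (⟨0, 0, 1, 0⟩ : ℍ[ℚ,-1,-7]) * ⟨(A : ℚ) + (C : ℚ) / 2, (B : ℚ) + (D : ℚ) / 2, (C : ℚ) / 2, (D : ℚ) / 2⟩ =
      ⟨((-A - 4 * C : ℤ) : ℚ) + ((2 * A + C : ℤ) : ℚ) / 2, ((B + 4 * D : ℤ) : ℚ) + ((-2 * B - D : ℤ) : ℚ) / 2,
        ((2 * A + C : ℤ) : ℚ) / 2, ((-2 * B - D : ℤ) : ℚ) / 2⟩ := by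
  ext <;> simp [QuaternionAlgebra.mk_mul_mk] <;> ring

/-- **`nrd j = 7`**: `j` is a uniformiser at the ramified prime. [cite: VignerasLNM800, Ch. II §1 Lemme 1.5] -/
theorem reducedNorm_basisJ : reducedNorm ℚ ℍ[ℚ,-1,-7] (⟨0, 0, 1, 0⟩ : ℍ[ℚ,-1,-7]) = 7 := by
  rw [reducedNorm_eq]
  norm_num

/-- `Q₇(−A−4C, B+4D, 2A+C, −2B−D) = 7·Q₇(A,B,C,D)` (`nrd(jx) = 7·nrd x`). [cite: Eichler1973, Ch. II §6 Thm. 2 (20)] -/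
theorem form_sevenMap (A B C D : ℤ) :
    (-A - 4 * C) ^ 2 + (-A - 4 * C) * (2 * A + C) + 2 * (2 * A + C) ^ 2 + (B + 4 * D) ^ 2 + (B + 4 * D) * (-2 * B - D) +
        2 * (-2 * B - D) ^ 2 = 7 * (A ^ 2 + A * C + 2 * C ^ 2 + B ^ 2 + B * D + 2 * D ^ 2) := by
  ring

/-- **`7 ∣ Q₇(a,b,c,d) ⟺ 2a + c ≡ 0 ∧ 2b + d ≡ 0 (mod 7)`** (`4Q₇ = (2a+c)² + 7c² + (2b+d)² + 7d²`, and a sum of two squares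
vanishes mod `7` only trivially: `O₇/jO₇ ≅ 𝔽₄₉` is a field). [cite: VignerasLNM800, Ch. II §1 Cor. 1.7] [cite: Voight2021, §13.3] -/
theorem seven_dvd_form_iff (a b c d : ℤ) :
    (7 : ℤ) ∣ a ^ 2 + a * c + 2 * c ^ 2 + b ^ 2 + b * d + 2 * d ^ 2 ↔ (7 : ℤ) ∣ 2 * a + c ∧ (7 : ℤ) ∣ 2 * b + d := by
  have key : ∀ x y z w : ZMod 7, x ^ 2 + x * z + 2 * z ^ 2 + y ^ 2 + y * w + 2 * w ^ 2 = 0 ↔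
      2 * x + z = 0 ∧ 2 * y + w = 0 := by decide
  have e₁ := ZMod.intCast_zmod_eq_zero_iff_dvd (a ^ 2 + a * c + 2 * c ^ 2 + b ^ 2 + b * d + 2 * d ^ 2) 7
  have e₂ := ZMod.intCast_zmod_eq_zero_iff_dvd (2 * a + c) 7
  have e₃ := ZMod.intCast_zmod_eq_zero_iff_dvd (2 * b + d) 7
  push_cast at e₁ e₂ e₃
  rw [← e₁, ← e₂, ← e₃]
  exact key _ _ _ _

/-- **`#{Q₇ = 7n} = #{Q₇ = n}`**: the `7`-map is a bijection from the solutions of `Q₇ = n` onto those of `Q₇ = 7n` (a solution of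
`Q₇ = 7n` satisfies the two congruences, and then `A = (a+4c)/7`, `B = −(b+4d)/7`, `C = −(2a+c)/7`, `D = (2b+d)/7` is its unique
preimage). [cite: Eichler1973, Ch. II §2 and §6 Thm. 2 (20)] -/
theorem natCard_form_seven_mul (n : ℤ) :
    Nat.card {v : ℤ × ℤ × ℤ × ℤ //
        v.1 ^ 2 + v.1 * v.2.2.1 + 2 * v.2.2.1 ^ 2 + v.2.1 ^ 2 + v.2.1 * v.2.2.2 + 2 * v.2.2.2 ^ 2 = 7 * n} =
      Nat.card {v : ℤ × ℤ × ℤ × ℤ //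
        v.1 ^ 2 + v.1 * v.2.2.1 + 2 * v.2.2.1 ^ 2 + v.2.1 ^ 2 + v.2.1 * v.2.2.2 + 2 * v.2.2.2 ^ 2 = n} := by
  symm
  refine Nat.card_congr (Equiv.ofBijective
    (fun v => ⟨(-v.1.1 - 4 * v.1.2.2.1, v.1.2.1 + 4 * v.1.2.2.2, 2 * v.1.1 + v.1.2.2.1, -2 * v.1.2.1 - v.1.2.2.2), by
      have h := form_sevenMap v.1.1 v.1.2.1 v.1.2.2.1 v.1.2.2.2
      rw [v.2] at h
      exact h⟩) ⟨?_, ?_⟩)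
  · rintro ⟨⟨A, B, C, D⟩, hv⟩ ⟨⟨A', B', C', D'⟩, hv'⟩ h
    simp only [Subtype.mk.injEq, Prod.mk.injEq] at h
    obtain ⟨h1, h2, h3, h4⟩ := h
    have hA : A = A' := by omega
    have hB : B = B' := by omega
    have hC : C = C' := by omega
    have hD : D = D' := by omega
    subst hA hB hC hD
    rfl
  · rintro ⟨⟨a, b, c, d⟩, h⟩
    have h7 : (7 : ℤ) ∣ a ^ 2 + a * c + 2 * c ^ 2 + b ^ 2 + b * d + 2 * d ^ 2 := ⟨n, h⟩
    obtain ⟨h₁, h₂⟩ := (seven_dvd_form_iff a b c d).1 h7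
    obtain ⟨A, hA⟩ : (7 : ℤ) ∣ a + 4 * c := by omega
    obtain ⟨B, hB⟩ : (7 : ℤ) ∣ -(b + 4 * d) := by omega
    obtain ⟨C, hC⟩ : (7 : ℤ) ∣ -(2 * a + c) := by omega
    obtain ⟨D, hD⟩ : (7 : ℤ) ∣ 2 * b + d := by omega
    refine ⟨⟨⟨A, B, C, D⟩, ?_⟩, ?_⟩
    · have ha : a = -A - 4 * C := by omega
      have hb : b = B + 4 * D := by omega
      have hc : c = 2 * A + C := by omega
      have hd : d = -2 * B - D := by omega
      have e := form_sevenMap A B C D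
      rw [← ha, ← hb, ← hc, ← hd, h] at e
      simpa using (mul_right_injective₀ (by norm_num : (7 : ℤ) ≠ 0) e).symm
    · simp only [Subtype.mk.injEq, Prod.mk.injEq]
      omega

/-- **`#{Q₇ = 7ᵃn} = #{Q₇ = n}`** for every `a`. [cite: Eichler1973, Ch. II §6 Thm. 2 (20)] -/
theorem natCard_form_seven_pow_mul (a : ℕ) (n : ℤ) :
    Nat.card {v : ℤ × ℤ × ℤ × ℤ //
        v.1 ^ 2 + v.1 * v.2.2.1 + 2 * v.2.2.1 ^ 2 + v.2.1 ^ 2 + v.2.1 * v.2.2.2 + 2 * v.2.2.2 ^ 2 = 7 ^ a * n} =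
      Nat.card {v : ℤ × ℤ × ℤ × ℤ //
        v.1 ^ 2 + v.1 * v.2.2.1 + 2 * v.2.2.1 ^ 2 + v.2.1 ^ 2 + v.2.1 * v.2.2.2 + 2 * v.2.2.2 ^ 2 = n} := by
  induction a with
  | zero => rw [pow_zero, one_mul]
  | succ a ih => rw [pow_succ, mul_comm ((7 : ℤ) ^ a) 7, mul_assoc, natCard_form_seven_mul, ih]

/-- **`r₇(7ᵃ) = 4`**: the number of `(a,b,c,d) ∈ ℤ⁴` with `Q₇(a,b,c,d) = 7ᵃ` is `4` for every `a` (the four `jᵃu`, `u ∈ O₇^× = {±1, ±i}`).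
[cite: Eichler1973, Ch. II §2 and §6 Thm. 2 (20)] [cite: Voight2021, Exercise 17.10] -/
theorem natCard_form_seven_pow (a : ℕ) :
    Nat.card {v : ℤ × ℤ × ℤ × ℤ //
        v.1 ^ 2 + v.1 * v.2.2.1 + 2 * v.2.2.1 ^ 2 + v.2.1 ^ 2 + v.2.1 * v.2.2.2 + 2 * v.2.2.2 ^ 2 = (7 : ℤ) ^ a} = 4 := by
  have h := natCard_form_seven_pow_mul a 1
  rw [mul_one] at h
  rw [h, natCard_form_eq_one]

end Form

/-! ## §2 For `O₇`: `#{nrd = 7n} = #{nrd = n}` -/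

section Order

/-- **`#{x ∈ O₇ : nrd x = 7n} = #{x ∈ O₇ : nrd x = n}`** (`x ↦ jx`). [cite: Eichler1973, Ch. II §2 and §6 Thm. 2 (20)] [cite: VignerasLNM800, Ch. II §1 Lemme 1.5] -/
theorem natCard_reducedNorm_seven_mul (n : ℕ) :
    Nat.card {x : ℍ[ℚ,-1,-7] // x ∈ (Submodule.span ℤ (Set.range ![(⟨1, 0, 0, 0⟩ : ℍ[ℚ,-1,-7]), ⟨0, 1, 0, 0⟩, ⟨1/2, 0, 1/2, 0⟩, ⟨0, 1/2, 0, 1/2⟩])) ∧ reducedNorm ℚ ℍ[ℚ,-1,-7] x = (7 * n : ℕ)} =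
      Nat.card {x : ℍ[ℚ,-1,-7] // x ∈ (Submodule.span ℤ (Set.range ![(⟨1, 0, 0, 0⟩ : ℍ[ℚ,-1,-7]), ⟨0, 1, 0, 0⟩, ⟨1/2, 0, 1/2, 0⟩, ⟨0, 1/2, 0, 1/2⟩])) ∧ reducedNorm ℚ ℍ[ℚ,-1,-7] x = n} := by
  have h7 := natCard_reducedNorm_eq_natCard_form ((7 * n : ℕ) : ℤ)
  have hn := natCard_reducedNorm_eq_natCard_form (n : ℤ)
  push_cast at h7 hn ⊢
  rw [h7, hn]
  exact natCard_form_seven_mul n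

/-- **`#{x ∈ O₇ : nrd x = 7ᵃ} = 4`** for every `a`. [cite: Eichler1973, Ch. II §2] [cite: Voight2021, Exercise 17.10] -/
theorem natCard_reducedNorm_seven_pow (a : ℕ) :
    Nat.card {x : ℍ[ℚ,-1,-7] // x ∈ (Submodule.span ℤ (Set.range ![(⟨1, 0, 0, 0⟩ : ℍ[ℚ,-1,-7]), ⟨0, 1, 0, 0⟩, ⟨1/2, 0, 1/2, 0⟩, ⟨0, 1/2, 0, 1/2⟩])) ∧ reducedNorm ℚ ℍ[ℚ,-1,-7] x = (7 ^ a : ℕ)} = 4 := by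
  have h := natCard_reducedNorm_eq_natCard_form ((7 ^ a : ℕ) : ℤ)
  push_cast at h ⊢
  rw [h]
  exact natCard_form_seven_pow a

/-- **For `x ∈ O₇` with `7 ∣ nrd x` there is `y ∈ O₇` with `x = jy`** (`𝔓 = jO₇` is the prime above `7`).
[cite: VignerasLNM800, Ch. II §1 Lemme 1.5] [cite: Voight2021, §13.3] -/
theorem exists_mem_eq_basisJ_mul_of_seven_dvd {x : ℍ[ℚ,-1,-7]} (hx : x ∈ (Submodule.span ℤ (Set.range ![(⟨1, 0, 0, 0⟩ : ℍ[ℚ,-1,-7]), ⟨0, 1, 0, 0⟩, ⟨1/2, 0, 1/2, 0⟩, ⟨0, 1/2, 0, 1/2⟩]))) (h7 : ∃ m : ℤ, reducedNorm ℚ ℍ[ℚ,-1,-7] x = 7 * m) :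
    ∃ y ∈ (Submodule.span ℤ (Set.range ![(⟨1, 0, 0, 0⟩ : ℍ[ℚ,-1,-7]), ⟨0, 1, 0, 0⟩, ⟨1/2, 0, 1/2, 0⟩, ⟨0, 1/2, 0, 1/2⟩])), x = ⟨0, 0, 1, 0⟩ * y := by
  obtain ⟨m, hm⟩ := h7
  obtain ⟨a, b, c, d, rfl⟩ := (mem_lattice_iff x).1 hx
  rw [reducedNorm_mk] at hm
  have h7 : (7 : ℤ) ∣ a ^ 2 + a * c + 2 * c ^ 2 + b ^ 2 + b * d + 2 * d ^ 2 := ⟨m, by exact_mod_cast hm⟩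
  obtain ⟨h₁, h₂⟩ := (seven_dvd_form_iff a b c d).1 h7
  obtain ⟨A, hA⟩ : (7 : ℤ) ∣ a + 4 * c := by omega
  obtain ⟨B, hB⟩ : (7 : ℤ) ∣ -(b + 4 * d) := by omega
  obtain ⟨C, hC⟩ : (7 : ℤ) ∣ -(2 * a + c) := by omega
  obtain ⟨D, hD⟩ : (7 : ℤ) ∣ 2 * b + d := by omega
  refine ⟨_, mk_mem_lattice A B C D, ?_⟩
  rw [basisJ_mul_mk]
  have ha : a = -A - 4 * C := by omega
  have hb : b = B + 4 * D := by omega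
  have hc : c = 2 * A + C := by omega
  have hd : d = -2 * B - D := by omega
  subst ha hb hc hd
  rfl

end Order

end Literature.NumberTheory.Automorphic.MaxOrderDiscSeven
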